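import Summits.KontsevichZagierPeriods.KontsevichZagierPeriods.Theorems.SymplecticScissorsRealOnePeriodRelationsStubCellsAux
import Summits.KontsevichZagierPeriods.KontsevichZagierPeriods.Theorems.SymplecticScissorsRealOnePeriodRelationsStubEulerLeadCell
import Mathlib.Analysis.SpecialFunctions.Sqrt
import HarnessLib

/-!
# `RealOnePeriodRelations` (stmt-KontsevichZagierPeriods-10042), line `nash-retraction-thin-strip`,
# reshape 9 (the conic layer): the stub `stub_eulerRootCell` — Euler's substitution through a real root

`ConicLayer.stub_eulerRootCell`: a conic representation `∫_{(a,b)} P(x) dx/(Q(x)√q(x))` with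
`q(x) = α(x − ρ)(x − ρ′)`, real algebraic `α < 0` and `ρ < a < b < ρ′` (so `q > 0` on `[a, b]`),
`P, Q ∈ K[X]` (`K = ℚ̄ ∩ ℝ`, Mathlib's `algebraicClosure ℚ ℝ`) and `Q ≠ 0` on `[a, b]`, is ONE
instance of Kontsevich–Zagier's rule (2) away from an algebraic-rational representation
`∫_{(a′,b′)} P′(t) dt/Q′(t)`, `P′, Q′ ∈ K[X]`, `a′ < b′` real algebraic, `Q′ ≠ 0` on `(a′, b′)`.

The move is EULER'S THIRD SUBSTITUTION `t = φ(x) = √q(x)/(x − ρ)`: `t² = α(x − ρ′)/(x − ρ)`,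
`x = ψ(t) = (αρ′ − ρt²)/(α − t²)`, `√q(x) = t(x − ρ)`, `φ′(x) = α(ρ′ − ρ)/(2√q(x)(x − ρ)) < 0`.
The chart `φ` is a `ℚ`-semialgebraic function of the coordinate on the cell (algebraic constants,
`√`, quotient) with `ℚ`-semialgebraic nowhere-zero derivative, strictly decreasing on `[a, b]`
(negative derivative), so the landed one-dimensional rule-2 push-forward
`HermiteRigidity.GenusTwoCycleTransfer.stub_pushforwardDimOne` (with the semialgebraic inverse of
`…stub_semialgebraicInvFunOn`) produces `r′` with `[r] − [r′] ∈ KZ.changeOfVariablesRel`, domain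
the cell of `(φ(b), φ(a))` (strict antitonicity and the intermediate value theorem; the end points
are real algebraic, `Euler.isAlgebraic_sqrt`) and integrand
`P(x)/(Q(x)√q(x)|φ′(x)|) = 2P(ψt)(ψt − ρ)/(Q(ψt)·(−α(ρ′ − ρ)))` at `t = φ(x)` — a `K`-rational
function of `t`, assembled by the `K`-rational bookkeeping `Euler.krat_*` of the tree's
`AbelContractionRealHyperellipticSectorStubEulerKit` and its `K`-coefficient complement
`ConicLayer.eulerLeadCell_krat_aevalK` of the sibling stub file `…StubEulerLeadCell` (Euler's first
substitution).  No definitions and no new helper declarations are introduced.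

References: M. Kontsevich, D. Zagier, *Periods* (2001), §1.2 rule (2); L. Euler, *Institutiones
calculi integralis* I (1768), §§ 88–99 (Euler's substitutions).
-/

noncomputable section

open scoped BigOperators Polynomial
open Set MeasureTheory MvPolynomial
open Literature.NumberTheory.Transcendental Literature.NumberTheory.Transcendental.CurvePeriods
open Summit.KontsevichZagierPeriods.AbelContraction.RealHyperellipticSector.Euler
  (krat_const krat_id krat_congr krat_add krat_mul krat_div krat_sub krat_pow isAlgebraic_sqrt)

namespace Summit.KontsevichZagierPeriods.SymplecticScissors.RealOnePeriodRelations.ConicLayer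

/-- STUB `stub_eulerRootCell` — **Euler's third substitution as ONE instance of rule (2).**  For `q = α(x − ρ)(x − ρ′)` with `α < 0`
and real algebraic roots `ρ < a < b < ρ′` (so `q > 0` on `[a, b]`) and an integrand `P(x)/(Q(x)·√q(x))` (`Q ≠ 0` on `[a, b]`), the
substitution `√q = t·(x − ρ)` (`x = (αρ′ − ρt²)/(α − t²)`, monotone and smooth on the arc) turns the representation into one with a
rational integrand with real algebraic coefficients on an interval with real algebraic end points: `[r] − [r′] ∈ (2)`.  The chart
`t = φ(x) = √q(x)/(x − ρ)` has `φ′ = α(ρ′ − ρ)/(2√q·(x − ρ)) < 0` on `[a, b]`, the new cell is `(φ(b), φ(a))`, the new integrand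
is `2P(ψt)(ψt − ρ)/(Q(ψt)·(−α(ρ′ − ρ)))`, `ψ(t) = (αρ′ − ρt²)/(α − t²)`, and `r′` is built by
`HermiteRigidity.GenusTwoCycleTransfer.stub_pushforwardDimOne`. [cite: KontsevichZagier2001, §1.2 (rule 2)] -/
theorem stub_eulerRootCell (α ρ ρ' a b : ℝ) (hα : IsAlgebraic ℚ α) (hρ : IsAlgebraic ℚ ρ) (hρ' : IsAlgebraic ℚ ρ')
    (ha : IsAlgebraic ℚ a) (hb : IsAlgebraic ℚ b) (hab : a < b) (hα0 : α < 0) (hρa : ρ < a) (hbρ' : b < ρ')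
    (P Q : Polynomial (algebraicClosure ℚ ℝ)) (hQ : ∀ x ∈ Set.Icc a b, Polynomial.aeval x Q ≠ 0)
    (r : KZ.IntegralRep 1) (hdom : r.domain = {z | z 0 ∈ Set.Ioo a b})
    (hint : ∀ z ∈ r.domain, r.integrand z =
      Polynomial.aeval (z 0) P / (Polynomial.aeval (z 0) Q * Real.sqrt (α * ((z 0) - ρ) * ((z 0) - ρ')))) :
    ∃ r' : KZ.IntegralRep 1,
      (∃ a' b' : ℝ, IsAlgebraic ℚ a' ∧ IsAlgebraic ℚ b' ∧ a' < b' ∧ r'.domain = {z | z 0 ∈ Set.Ioo a' b'} ∧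
        ∃ P' Q' : Polynomial (algebraicClosure ℚ ℝ), (∀ t ∈ Set.Ioo a' b', Polynomial.aeval t Q' ≠ 0) ∧
          ∀ t ∈ Set.Ioo a' b', r'.integrand (fun _ => t) = Polynomial.aeval t P' / Polynomial.aeval t Q') ∧
      KZ.of r - KZ.of r' ∈ KZ.changeOfVariablesRel := by
  have hmem : ∀ p, p ∈ r.domain ↔ p 0 ∈ Ioo a b := fun p => by rw [hdom]; rfl
  have hσ := r.isSemialgebraic_domain
  have hρρ' : 0 < ρ' - ρ := by linarith
  -- the radicand `q = α(x − ρ)(x − ρ′)`, positive on `[a, b]`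
  obtain ⟨q, hq⟩ : ∃ q : ℝ → ℝ, ∀ x, q x = α * (x - ρ) * (x - ρ') := ⟨_, fun _ => rfl⟩
  have hxρ : ∀ x ∈ Icc a b, 0 < x - ρ := fun x hx => by linarith [hx.1]
  have hpos : ∀ x ∈ Icc a b, 0 < q x := fun x hx => by
    rw [hq]
    exact mul_pos_of_neg_of_neg (mul_neg_of_neg_of_pos hα0 (hxρ x hx)) (by linarith [hx.2])
  have hsq : ∀ x ∈ Icc a b, 0 < √(q x) := fun x hx => Real.sqrt_pos.mpr (hpos x hx)
  -- the chart `φ = √q/(x − ρ)`, its derivative `φ'` and its inverse `ψ`, as opaque functions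
  obtain ⟨φ, hφ⟩ : ∃ φ : ℝ → ℝ, ∀ x, φ x = √(q x) / (x - ρ) := ⟨_, fun _ => rfl⟩
  obtain ⟨φ', hφ'⟩ : ∃ φ' : ℝ → ℝ, ∀ x, φ' x = α * (ρ' - ρ) / (2 * √(q x) * (x - ρ)) :=
    ⟨_, fun _ => rfl⟩
  obtain ⟨ψ, hψ⟩ : ∃ ψ : ℝ → ℝ, ∀ t, ψ t = (α * ρ' - t ^ 2 * ρ) / (α - t ^ 2) :=
    ⟨_, fun _ => rfl⟩
  have hmemI : ∀ p ∈ r.domain, p 0 ∈ Icc a b := fun p hp => Ioo_subset_Icc_self ((hmem p).1 hp)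
  -- semialgebraicity of `φ`, `φ'` on the cell (algebraic constants, `√`, quotients)
  have hx0 : IsSemialgebraicFunOn ℚ r.domain (fun p : Fin 1 → ℝ => p 0) := by
    simpa using isSemialgebraicFunOn_aeval hσ (MvPolynomial.X 0 : MvPolynomial (Fin 1) ℚ)
  have hxρsa : IsSemialgebraicFunOn ℚ r.domain (fun p => p 0 - ρ) :=
    hx0.fun_sub (isSemialgebraicFunOn_const_of_isAlgebraic hσ hρ)
  have hqsa : IsSemialgebraicFunOn ℚ r.domain (fun p => q (p 0)) :=
    (((isSemialgebraicFunOn_const_of_isAlgebraic hσ hα).fun_mul hxρsa).fun_mul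
      (hx0.fun_sub (isSemialgebraicFunOn_const_of_isAlgebraic hσ hρ'))).congr
      fun p _ => (hq (p 0)).symm
  have hφsa : IsSemialgebraicFunOn ℚ r.domain (fun p => φ (p 0)) :=
    (hqsa.fun_sqrt.div hxρsa fun p hp => (hxρ _ (hmemI p hp)).ne').congr
      fun p _ => (hφ (p 0)).symm
  have hφ'sa : IsSemialgebraicFunOn ℚ r.domain (fun p => φ' (p 0)) :=
    ((isSemialgebraicFunOn_const_of_isAlgebraic hσ (hα.mul (hρ'.sub hρ))).div
      (((isSemialgebraicFunOn_const_ofNat hσ 2).fun_mul hqsa.fun_sqrt).fun_mul hxρsa)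
      fun p hp => mul_ne_zero (mul_ne_zero two_ne_zero (hsq _ (hmemI p hp)).ne')
        (hxρ _ (hmemI p hp)).ne').congr fun p _ => (hφ' (p 0)).symm
  -- the derivative of the chart on `[a, b]`
  have hq' : ∀ x, HasDerivAt q (α * 1 * (x - ρ') + α * (x - ρ) * 1) x := fun x => by
    have e : q = fun y => α * (y - ρ) * (y - ρ') := funext hq
    rw [e]
    exact (((hasDerivAt_id' x).sub_const ρ).const_mul α).mul ((hasDerivAt_id' x).sub_const ρ')
  have hder : ∀ x ∈ Icc a b, HasDerivAt φ (φ' x) x := fun x hx => by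
    have h1 := hsq x hx
    have h2 := (hxρ x hx).ne'
    have hs2 : √(q x) * √(q x) = α * (x - ρ) * (x - ρ') := by
      rw [Real.mul_self_sqrt (hpos x hx).le, hq]
    have e : φ = fun y => √(q y) / (y - ρ) := funext hφ
    rw [e, hφ']
    refine (((hq' x).sqrt (hpos x hx).ne').div ((hasDerivAt_id' x).sub_const ρ) h2).congr_deriv ?_
    have e1 : (α * 1 * (x - ρ') + α * (x - ρ) * 1) / (2 * √(q x)) * (x - ρ) - √(q x) * 1 =
        α * (x - ρ) * (ρ' - ρ) / (2 * √(q x)) := by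
      field_simp
      linear_combination (-2) * hs2
    rw [e1]
    field_simp
  have hφ'neg : ∀ x ∈ Icc a b, φ' x < 0 := fun x hx => by
    rw [hφ']
    exact div_neg_of_neg_of_pos (mul_neg_of_neg_of_pos hα0 hρρ')
      (mul_pos (mul_pos two_pos (hsq x hx)) (hxρ x hx))
  -- `φ` is continuous and strictly decreasing on `[a, b]`: the image of the cell is a cell
  have hcont : ContinuousOn φ (Icc a b) := fun x hx => (hder x hx).continuousAt.continuousWithinAt
  have hanti : StrictAntiOn φ (Icc a b) :=
    strictAntiOn_of_deriv_neg (convex_Icc a b) hcont fun x hx => by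
      rw [interior_Icc] at hx
      rw [(hder x (Ioo_subset_Icc_self hx)).deriv]
      exact hφ'neg x (Ioo_subset_Icc_self hx)
  have haI : a ∈ Icc a b := left_mem_Icc.2 hab.le
  have hbI : b ∈ Icc a b := right_mem_Icc.2 hab.le
  have himage : φ '' Ioo a b = Ioo (φ b) (φ a) := by
    refine Subset.antisymm ?_ (intermediate_value_Ioo' hab.le hcont)
    rintro _ ⟨x, hx, rfl⟩
    exact ⟨hanti (Ioo_subset_Icc_self hx) hbI hx.2, hanti haI (Ioo_subset_Icc_self hx) hx.1⟩
  -- the inverse chart: `ψ (φ x) = x` on `[a, b]`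
  have hφsq : ∀ x ∈ Icc a b, φ x ^ 2 = α * (x - ρ') / (x - ρ) := fun x hx => by
    have h2 := (hxρ x hx).ne'
    rw [hφ, div_pow, Real.sq_sqrt (hpos x hx).le, hq, div_eq_div_iff (pow_ne_zero 2 h2) h2]
    ring
  have hden : ∀ x ∈ Icc a b, α - φ x ^ 2 = α * (ρ' - ρ) / (x - ρ) := fun x hx => by
    have h2 := (hxρ x hx).ne'
    rw [hφsq x hx, eq_div_iff h2]
    field_simp
    ring
  have hden0 : ∀ x ∈ Icc a b, α - φ x ^ 2 ≠ 0 := fun x hx => by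
    rw [hden x hx]
    exact (div_neg_of_neg_of_pos (mul_neg_of_neg_of_pos hα0 hρρ') (hxρ x hx)).ne
  have hψφ : ∀ x ∈ Icc a b, ψ (φ x) = x := fun x hx => by
    have h2 := (hxρ x hx).ne'
    rw [hψ, div_eq_iff (hden0 x hx), hφsq x hx]
    field_simp
    ring
  -- rule (2): the push-forward of `r` along `φ`
  have hinj : InjOn (fun p : Fin 1 → ℝ => fun _ : Fin 1 => φ (p 0)) r.domain := by
    intro p hp p' hp' h
    have h1 : φ (p 0) = φ (p' 0) := congrFun h 0
    have h2 : p 0 = p' 0 := hanti.injOn (hmemI p hp) (hmemI p' hp') h1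
    rw [KZ.eq_const_apply_zero p, KZ.eq_const_apply_zero p', h2]
  have hΦsa : IsSemialgebraicMapOn ℚ r.domain (fun p : Fin 1 → ℝ => fun _ : Fin 1 => φ (p 0)) :=
    IsSemialgebraicMapOn.of_forall hσ fun _ => hφsa
  have hG := HermiteRigidity.GenusTwoCycleTransfer.stub_semialgebraicInvFunOn hΦsa hinj
  obtain ⟨s, hs, hsi, hrel⟩ := HermiteRigidity.GenusTwoCycleTransfer.stub_pushforwardDimOne r φ φ'
    _ hφsa hφ'sa (fun p hp => hder _ (hmemI p hp)) (fun p hp => (hφ'neg _ (hmemI p hp)).ne) hG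
    (fun p hp => hinj.leftInvOn_invFunOn hp)
  have hsdom : s.domain = {z | z 0 ∈ Ioo (φ b) (φ a)} := by
    rw [hs, ← himage]
    ext z
    constructor
    · rintro ⟨p, hp, rfl⟩
      exact ⟨p 0, (hmem p).1 hp, rfl⟩
    · rintro ⟨x, hx, hxz⟩
      refine ⟨fun _ => x, (hmem _).2 hx, ?_⟩
      rw [KZ.eq_const_apply_zero z]
      funext i
      exact hxz
  -- the pushed-forward integrand `2P(ψt)(ψt − ρ)/(Q(ψt)(−α(ρ′ − ρ)))` is `K`-rational in `t`
  have h2A : IsAlgebraic ℚ (2 : ℝ) := by simpa using isAlgebraic_nat (R := ℚ) (A := ℝ) 2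
  have hψT : ∃ P₁ Q₁ : (algebraicClosure ℚ ℝ)[X], ∀ t ∈ Ioo (φ b) (φ a),
      (Polynomial.aeval t Q₁ : ℝ) ≠ 0 ∧
        ψ t = (Polynomial.aeval t P₁ : ℝ) / (Polynomial.aeval t Q₁ : ℝ) := by
    refine krat_congr (krat_div (krat_sub (krat_const _ (hα.mul hρ'))
      (krat_mul (krat_pow (krat_id _) 2) (krat_const _ hρ)))
      (krat_sub (krat_const _ hα) (krat_pow (krat_id _) 2)) ?_) fun t _ => (hψ t).symm
    intro t ht
    rw [← himage] at ht
    obtain ⟨x, hx, rfl⟩ := ht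
    exact hden0 x (Ioo_subset_Icc_self hx)
  have hQT : ∀ t ∈ Ioo (φ b) (φ a),
      (Polynomial.aeval (ψ t) Q : ℝ) * -(α * (ρ' - ρ)) ≠ 0 := by
    intro t ht
    rw [← himage] at ht
    obtain ⟨x, hx, rfl⟩ := ht
    rw [hψφ x (Ioo_subset_Icc_self hx)]
    exact mul_ne_zero (hQ x (Ioo_subset_Icc_self hx))
      (neg_ne_zero.2 (mul_ne_zero hα0.ne hρρ'.ne'))
  obtain ⟨P', Q', hPQ'⟩ : ∃ P' Q' : (algebraicClosure ℚ ℝ)[X], ∀ t ∈ Ioo (φ b) (φ a),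
      (Polynomial.aeval t Q' : ℝ) ≠ 0 ∧
      (fun t => 2 * (Polynomial.aeval (ψ t) P : ℝ) * (ψ t - ρ) /
          ((Polynomial.aeval (ψ t) Q : ℝ) * -(α * (ρ' - ρ)))) t =
        (Polynomial.aeval t P' : ℝ) / (Polynomial.aeval t Q' : ℝ) :=
    krat_div (krat_mul (krat_mul (krat_const _ h2A) (eulerLeadCell_krat_aevalK P hψT))
      (krat_sub hψT (krat_const _ hρ)))
      (krat_mul (eulerLeadCell_krat_aevalK Q hψT) (krat_const _ (hα.mul (hρ'.sub hρ)).neg)) hQT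
  refine ⟨s, ⟨φ b, φ a, ?_, ?_, hanti haI hbI hab, hsdom, P', Q', fun t ht => (hPQ' t ht).1,
    fun t ht => ?_⟩, hrel⟩
  · -- `φ b` is real algebraic
    rw [hφ, hq, div_eq_mul_inv]
    exact (isAlgebraic_sqrt ((hα.mul (hb.sub hρ)).mul (hb.sub hρ'))).mul (hb.sub hρ).inv
  · -- `φ a` is real algebraic
    rw [hφ, hq, div_eq_mul_inv]
    exact (isAlgebraic_sqrt ((hα.mul (ha.sub hρ)).mul (ha.sub hρ'))).mul (ha.sub hρ).inv
  · -- the integrand of the push-forward at `t = φ x`: the Jacobian identity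
    have ht' : t ∈ φ '' Ioo a b := by rwa [himage]
    obtain ⟨x, hx, rfl⟩ := ht'
    have hxI : x ∈ Icc a b := Ioo_subset_Icc_self hx
    have hp : (fun _ : Fin 1 => x) ∈ r.domain := (hmem _).2 hx
    have key : s.integrand (fun _ => φ x) = r.integrand (fun _ => x) / |φ' x| := hsi _ hp
    have hintx : r.integrand (fun _ => x) =
        Polynomial.aeval x P / (Polynomial.aeval x Q * √(α * (x - ρ) * (x - ρ'))) := hint _ hp
    rw [← (hPQ' _ ht).2]
    beta_reduce
    rw [key, hintx, hψφ x hxI, abs_of_neg (hφ'neg x hxI), hφ', ← hq]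
    have h1 := (hsq x hxI).ne'
    have h2 := (hxρ x hxI).ne'
    have h3 := hQ x hxI
    have h4 := hα0.ne
    have h5 := hρρ'.ne'
    field_simp

end Summit.KontsevichZagierPeriods.SymplecticScissors.RealOnePeriodRelations.ConicLayer

end
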